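import Mathlib

/-!
# LINE `valuative_door` (crux `WeakLifting`, stmt-ValiantsHypothesis-19561) — the support def `ConvexRung` of
# `Cruxes/WeakLifting/Lines/valuative_door.lean` (rev 2 @84c5f76c6d22), PROVED in its unfolded form

HONEST FRAMING.  Helper (cell `pub-symmetroid`, seat val-sym-lift-p1 g21, 2026-08-29; `--supports 19561 --as helper`).  The line's
`ConvexRung` is the checkable [folklore] rung behind its Theta witness vΘ: over any field `F` with an absolute value `v` and
`0 < v 2 < 1`, ALL `N` exponents of `Σ_{i<N} 2^{i²} X^i` are dominant (each strictly dominates every other term at some radius), i.e.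
the skeleton's `domCount` of this polynomial is `N`.  Reason: the coefficient valuations `log v (2^{i²}) = i² · log v 2` are a strictly
CONCAVE profile, so at the radius `r = (v 2)^{-2E}` the term of exponent `E` beats the term of exponent `E'` by the factor
`(v 2)^{(E − E')²} < 1`.  The statement below is the def `ConvexRung` with `domCount` UNFOLDED, binder for binder (the line file gets
its def by `exact`); the `IsNonarchimedean` binder is carried and unused.  Support rung only: nothing here is a stub of the line, closes
anything, or bears on vW / vB / `ValRankOneLaw`, `TropicalB`, `MatrixDescartes` (18050) or VP ≠ VNP.  [folklore; elementary]
-/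

set_option linter.dupNamespace false
set_option autoImplicit false

namespace Summit.ValiantsHypothesis.ValiantsHypothesis.Theorems.KPlusLogSqLaw.ValDoor

open Polynomial Finset
open scoped BigOperators Classical

/-- coefficients of the convex rung polynomial. [bookkeeping] -/
theorem coeff_convexRung {F : Type*} [Field F] (N j : ℕ) :
    (∑ i ∈ Finset.range N, C ((2 : F) ^ (i ^ 2)) * X ^ i).coeff j = if j < N then (2 : F) ^ (j ^ 2) else 0 := by
  rw [Polynomial.finsetSum_coeff]
  simp only [Polynomial.coeff_C_mul_X_pow]
  rw [Finset.sum_ite_eq]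
  simp only [Finset.mem_range]

/-- support of the convex rung polynomial (when `2 ≠ 0` in `F`). [bookkeeping] -/
theorem mem_support_convexRung {F : Type*} [Field F] (h2 : (2 : F) ≠ 0) (N j : ℕ) :
    j ∈ (∑ i ∈ Finset.range N, C ((2 : F) ^ (i ^ 2)) * X ^ i).support ↔ j < N := by
  rw [Polynomial.mem_support_iff, coeff_convexRung]
  constructor
  · intro h
    by_contra hj
    exact h (if_neg hj)
  · intro hj
    rw [if_pos hj]
    exact pow_ne_zero _ h2

/-- the exponent comparison behind strict concavity: `E² + 2·E·E' < E'² + 2·E²` for `E ≠ E'`. [bookkeeping] -/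
theorem sq_add_two_mul_lt {E E' : ℕ} (hne : E' ≠ E) : E ^ 2 + 2 * E * E' < E' ^ 2 + 2 * E ^ 2 := by
  have h1 : ((E : ℤ) - E') ≠ 0 := by
    intro h
    apply hne
    omega
  have h2 : (0 : ℤ) < ((E : ℤ) - E') ^ 2 := by
    rcases lt_or_gt_of_ne h1 with h | h <;> nlinarith
  zify
  nlinarith [h2]

/-- **`ConvexRung` UNFOLDED (the line's support def, literally):** for every field `F` with an absolute value `v`, `0 < v 2 < 1`, and every
`N`, all `N` exponents of `Σ_{i<N} 2^{i²} X^i` strictly dominate at some radius — the skeleton's `domCount` of it equals `N`.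
[folklore; strictly concave valuation profile] -/
theorem convexRung_unfolded :
    ∀ (F : Type) [Field F] (v : AbsoluteValue F ℝ), IsNonarchimedean v → 0 < v 2 → v 2 < 1 →
      ∀ N : ℕ, ((∑ i ∈ Finset.range N, Polynomial.C ((2 : F) ^ (i ^ 2)) * Polynomial.X ^ i).support.filter fun E =>
          ∃ r : ℝ, 0 < r ∧ ∀ E' ∈ (∑ i ∈ Finset.range N, Polynomial.C ((2 : F) ^ (i ^ 2)) * Polynomial.X ^ i).support, E' ≠ E →
            v ((∑ i ∈ Finset.range N, Polynomial.C ((2 : F) ^ (i ^ 2)) * Polynomial.X ^ i).coeff E') * r ^ E'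
              < v ((∑ i ∈ Finset.range N, Polynomial.C ((2 : F) ^ (i ^ 2)) * Polynomial.X ^ i).coeff E) * r ^ E).card = N := by
  intro F _ v _ h2pos h2lt N
  have h2ne : (2 : F) ≠ 0 := by
    intro h
    rw [h, map_zero] at h2pos
    exact lt_irrefl _ h2pos
  set q : ℝ := v 2 with hq
  -- every support exponent is dominant, at the radius q^(-2E)
  rw [Finset.filter_true_of_mem]
  · -- the support is `range N`
    have hs : (∑ i ∈ Finset.range N, Polynomial.C ((2 : F) ^ (i ^ 2)) * Polynomial.X ^ i).support = Finset.range N := by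
      ext j
      rw [mem_support_convexRung h2ne, Finset.mem_range]
    rw [hs, Finset.card_range]
  · intro E hE
    have hEN := (mem_support_convexRung h2ne N E).1 hE
    refine ⟨(q⁻¹) ^ (2 * E), by positivity, fun E' hE' hne => ?_⟩
    have hE'N := (mem_support_convexRung h2ne N E').1 hE'
    rw [coeff_convexRung, coeff_convexRung, if_pos hEN, if_pos hE'N, map_pow, map_pow, ← hq, ← pow_mul, ← pow_mul, inv_pow,
      inv_pow, ← div_eq_mul_inv, ← div_eq_mul_inv, div_lt_div_iff₀ (by positivity) (by positivity), ← pow_add, ← pow_add]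
    -- q ^ (E'^2 + 2E·E) < q ^ (E^2 + 2E·E')  ⟸  E^2 + 2EE' < E'^2 + 2E^2, base in (0,1)
    have hlt : E ^ 2 + 2 * E * E' < E' ^ 2 + 2 * E * E := by
      have := sq_add_two_mul_lt hne
      nlinarith [this]
    exact pow_right_strictAnti₀ h2pos h2lt hlt

end Summit.ValiantsHypothesis.ValiantsHypothesis.Theorems.KPlusLogSqLaw.ValDoor
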